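import Summits.NavierStokesRegularity.NavierStokesRegularity.Theorems.ExtremiserTransienceNearExtremalTransienceExtremiserLiouvilleConstantSpeedMultiplierExtension
import Literature.Analysis.FluidPDE.VorticityCalculus
import Literature.Analysis.FluidPDE.TaoEnstrophyLocalisationProofs
import Literature.Analysis.FluidPDE.ConstantinFeffermanEnstrophySlab
import HarnessLib.Audit

/-!
# LINE g7-3 «l2_budget» — TARGET T-i DECOMPOSED: construction ∧ sign law ∧ rates ⇒ tail kit

Crux `ExtremiserTransience.NearExtremalTransience` (stmt-NavierStokesRegularity-21883), ideator seat ns-idea-10 g7 (files-only workfile;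
companion of `Lines/l2_budget_tail.lean`, whose ONE remaining `sorry` is `target_tailKit` (T-i): a TAIL KIT exists in every direction).
NO summit, NO crux, NO K1b is proved here; NS regularity is OPEN.  No summit is proved by a line.

T-i asks for an explicit field `K = curl A` with eleven properties; ten are about the field alone, the eleventh quantifies over all
constant-speed fields `(w, c, M)` and asks `A1(w, K(·/s)) ≥ 0`, `J1 = O(1/s)`, `C1 = O(1/s)`.  This file splits T-i into THREE typed
targets of different nature and PROVES the assembly `target_tailKit_of : (T-i-a) → (T-i-b) → (T-i-c) → T-i` (T-i stated
character-identically):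

* **T-i-a `target_shellField` (CONSTRUCTION; M, explicit ODE/potential theory).**  For every unit `e` a field `K = curl A` with the ten
  field properties (`IsKitField`) AND the SHELL STRUCTURE (`IsShellStructure`): smooth `ψ, h : ℝ³ → ℝ` with `curl K = curl(ψ e)`,
  `Δψ = h ≥ 0`, `h` supported in the open shell `1 < ‖x‖ < 2`, and the Newtonian decay `|ψ| ≲ (1+r)⁻¹`, `|Dψ| ≲ (1+r)⁻²`,
  `|D²ψ| ≲ (1+r)⁻³`, `|D³ψ| ≲ (1+r)⁻⁴`.  Intended witness: `h ≥ 0` a smooth radial shell density, `ψ = Γ ∗ h` (`Γ = −1/(4πr)`, so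
  `Δψ = h`, `ψ = −m/(4πr)` for `r ≥ 2`, `ψ ≡ ψ(0)` on `B₁`), `Ψ` the radial solution of `ΔΨ = ψ` (`r²Ψ′ = G(r) = ∫₀ʳ ψt²dt`),
  `A = e × ∇Ψ = (G(r)/r³)(e × x)` (bounded, `DᵏA = O(r^{-k})`, linear on `B₁`), `K = curl A = −curl curl(Ψe) = ψe − ∇∂ₑΨ = ℙ(ψe)`
  (so `curl K = curl(ψe)`; `K ≡ (2ψ(0)/3)e` on `B₁` by Newton's theorem); the weight `⟪K(x) − K(0), e⟫ = ψ − ∂ₑ∂ₑΨ − 2ψ(0)/3 ≥ 0`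
  is the superposition over shell radii `ρ` of `(2/3ρ)·f(ρ/‖x‖, cos²∠(x,e)) ≥ 0` (`f` certified in `Lines/kernel_budget_weight.lean`),
  with floor `κ` beyond `Λ` (e.g. `5/24·(2|ψ(0)|)` at `Λ = 8`).
* **T-i-b `target_signLaw` (the SIGN LAW; M, the one structural computation).**  For a kit field with shell structure and every
  constant-speed field with `c = M e`: `A1(w, K(·/s)) ≥ 0` for `s ≥ 1`.  Route: `curl K_s = curl(ψ_s e)` with `ψ_s = ψ(·/s)`,
  `Δψ_s = s⁻²h(·/s) ≥ 0`; pointwise `⟪ω, ∇ψ × e⟫ = ⟪∇ψ, e × ω⟫ = ⟪∇ψ, ∇w_e⟫ − ⟪∇ψ, ∂ₑw⟩` (`e × curl w = ∇(e·w) − (e·∇)w`);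
  `w_e = M − q`, `q := ‖w − c‖²/(2M) ≥ 0` (because `‖w‖ ≡ M = ‖c‖`, `c = Me`); integrating by parts AGAINST RADIAL CUTOFFS `χ_R`
  (whole-space `W^{1,1}` fails by a hair: `∇ψ·(w − c) ∼ r⁻²·o(1)` need not be integrable) and letting `R → ∞` with the uniform decay
  `sup_{‖x‖>R}‖w − c‖ → 0`, `|∇ψ| ≲ R⁻²`, `|∇χ_R| ≲ R⁻¹` on the shell of volume `≍ R³`: `∫⟪∇ψ, ∇w_e⟫ = ∫ (Δψ) q` and
  `∫⟪∇ψ, ∂ₑw⟫ = −∫(w − c)·∇∂ₑψ = ∫ ∂ₑψ · div(w − c) = 0`; hence **`A1(w, K_s) = (2M)⁻¹ s⁻² ∫ h(x/s)‖w(x) − c‖² dx ≥ 0`**.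
  (Absolute convergence of every bulk integral: `|∇ψ||∇w| ∈ L¹` (`r⁻² ∈ L²`, `∇w ∈ L²`), `|D²ψ||w − c| ∈ L¹` (`r⁻³ ∈ L^{6/5}`,
  `w − c ∈ L⁶`).)  Why it might fail: it is an identity; only the cutoff bookkeeping is work.
* **T-i-c `target_rates` (RATES; S/M, analysis routine).**  For a kit field with shell structure and every constant-speed field:
  `|J1(w, K(·/s))| ≤ C_J/s` and `|C1(w, K(·/s))| ≤ C_C/s` for `s ≥ 1`.  Route: `DK_s = s⁻¹(DK)(·/s)`, `curl K_s = s⁻¹(curl K)(·/s)`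
  (`…KKTTailTools.fderiv_rescale`, `curl_rescale`), so each of the three terms of `J1` has one bounded `O(s⁻¹)` factor and two `L²`
  factors (`ω`, `Dw`): `|J1| ≤ s⁻¹(2‖curl K‖_∞‖Dw‖₂‖ω‖₂ + ‖DK‖_∞‖ω‖₂²)`.  For `C1` Cauchy–Schwarz alone gives only `O(s^{-1/2})`
  (`‖∇curl K_s‖₂ = s^{-1/2}‖∇curl K‖₂`) — NOT ENOUGH (T needs `O(1/s)`): integrate by parts once,
  `C1(w, K_s) = −∫⟪ω, Δ curl K_s⟫`, `Δ curl K_s = s⁻³(Δ curl K)(·/s)` and `Δ curl K = curl(Δψ e) = curl(h e) = ∇h × e` is bounded and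
  supported in the shell, so `|C1| ≤ s⁻³‖∇h‖_∞ (s³|shell₁|)^{1/2}‖ω‖₂ = O(s^{-3/2})`.  (This IBP is whole-space legitimate:
  `⟪ω, ∂ᵢcurl K_s⟫ ∈ W^{1,1}` since `ω, ∇ω ∈ L²`, `∇curl K = O(r⁻³) ∈ L²`, `Δ curl K` bounded with compact support.)
  Why it might fail: it cannot, given the structure; cost = one integration by parts on `ℝ³` (cf. `…BlowDownVorticityTools`,
  `…MultiplierExtension` for the pattern).

PROVED here: `target_tailKit_of` (assembly), and the small conversions.  BC7 probes on the three targets: see the card.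
-/

noncomputable section

open Set Filter Topology MeasureTheory Metric Function
open scoped ENNReal NNReal Topology InnerProductSpace RealInnerProductSpace ContDiff Laplacian
open Literature.Analysis.FluidPDE Literature.Analysis

namespace Summit.NavierStokesRegularity.NavierStokesRegularity.Cruxes.NearExtremalTransience.L2Budget.Kit

open Summit.NavierStokesRegularity.NavierStokesRegularity.Theorems
open Summit.NavierStokesRegularity.NavierStokesRegularity.Theorems.DepletionLadder
open Summit.NavierStokesRegularity.NavierStokesRegularity.Theorems.DepletionLadder.KStar
open Summit.NavierStokesRegularity.NavierStokesRegularity.Theorems.DepletionLadder.KStar.HalfSpace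
open Summit.NavierStokesRegularity.NavierStokesRegularity.Theorems.ExtremiserLiouville

set_option linter.unusedVariables false
set_option linter.dupNamespace false
set_option linter.style.longLine false

/-! ## Copies (character-identical with `Lines/l2_budget_tail.lean`) of `IsConstSpeedField`, `IsTailKit` -/

/-- The analytic part of the package that the explicit-field estimates use. -/
def IsConstSpeedField (w : E3 → E3) (c : E3) (M : ℝ) : Prop :=
  ContDiff ℝ (⊤ : ℕ∞) w ∧ VectorCalculus.IsDivFree w ∧ (∃ B : ℝ, ∀ x, ‖fderiv ℝ w x‖ ≤ B) ∧
  (∫⁻ x, ‖iteratedFDeriv ℝ 1 w x‖ₑ ^ 2 < ⊤) ∧ (∫⁻ x, ‖iteratedFDeriv ℝ 2 w x‖ₑ ^ 2 < ⊤) ∧ (∀ x, ‖w x‖ = M) ∧ 0 < M ∧ ‖c‖ = M ∧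
  Tendsto (fun x => w x - c) (cocompact E3) (𝓝 0) ∧ MemLp (fun x => w x - c) 6 volume

/-- A TAIL KIT in the direction `e`: potential `A` in E's class, `K = curl A` constant on the closed unit ball and bounded, non-negative
weight `⟪K − K(0), e⟫` with a positive floor `κ` beyond radius `Λ ≥ 2`, and the three pairing estimates against every constant-speed field
with far field `M e`: `A1 ≥ 0`, `J1 = O(1/s)`, `C1 = O(1/s)` along the rescaled family `K(·/s)`. -/
def IsTailKit (e : E3) (A K : E3 → E3) (CK κ Λ : ℝ) : Prop :=
  ContDiff ℝ ∞ A ∧ (∃ C : ℝ, (∀ x, ‖A x‖ ≤ C) ∧ ∀ k : ℕ, 1 ≤ k → k ≤ 3 → ∀ x, ‖iteratedFDeriv ℝ k A x‖ ≤ C * ((1 + ‖x‖) ^ k)⁻¹) ∧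
  K = curl A ∧ (∀ x, ‖x‖ ≤ 1 → K x = K 0) ∧ 0 ≤ CK ∧ (∀ x, ‖K x‖ ≤ CK) ∧ 0 < κ ∧ 2 ≤ Λ ∧
  (∀ x, 0 ≤ ⟪K x - K 0, e⟫_ℝ) ∧ (∀ x, Λ ≤ ‖x‖ → κ ≤ ⟪K x - K 0, e⟫_ℝ) ∧
  (∀ (w : E3 → E3) (c : E3) (M : ℝ), IsConstSpeedField w c M → c = M • e →
    (∀ s : ℝ, 1 ≤ s → 0 ≤ A1 w (fun x => K (s⁻¹ • x))) ∧
    (∃ CJ : ℝ, ∀ s : ℝ, 1 ≤ s → |J1 w (fun x => K (s⁻¹ • x))| ≤ CJ / s) ∧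
    (∃ CC : ℝ, ∀ s : ℝ, 1 ≤ s → |C1 w (fun x => K (s⁻¹ • x))| ≤ CC / s))

/-! ## The split of the kit: field part, shell structure -/

/-- Items 1–10 of `IsTailKit` (everything about the field alone). -/
def IsKitField (e : E3) (A K : E3 → E3) (CK κ Λ : ℝ) : Prop :=
  ContDiff ℝ ∞ A ∧ (∃ C : ℝ, (∀ x, ‖A x‖ ≤ C) ∧ ∀ k : ℕ, 1 ≤ k → k ≤ 3 → ∀ x, ‖iteratedFDeriv ℝ k A x‖ ≤ C * ((1 + ‖x‖) ^ k)⁻¹) ∧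
  K = curl A ∧ (∀ x, ‖x‖ ≤ 1 → K x = K 0) ∧ 0 ≤ CK ∧ (∀ x, ‖K x‖ ≤ CK) ∧ 0 < κ ∧ 2 ≤ Λ ∧
  (∀ x, 0 ≤ ⟪K x - K 0, e⟫_ℝ) ∧ (∀ x, Λ ≤ ‖x‖ → κ ≤ ⟪K x - K 0, e⟫_ℝ)

/-- The SHELL STRUCTURE of the intended witness `K = ℙ(ψ e)`: `curl K = curl(ψ e)` with `Δψ = h ≥ 0` smooth, supported in the open
shell `1 < ‖x‖ < 2`, and Newtonian decay of `ψ` and its first three derivatives (constant `Cψ`). -/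
def IsShellStructure (e : E3) (K : E3 → E3) (ψ h : E3 → ℝ) (Cψ : ℝ) : Prop :=
  ContDiff ℝ (⊤ : ℕ∞) ψ ∧ ContDiff ℝ (⊤ : ℕ∞) h ∧ (∀ x, curl K x = curl (fun y => ψ y • e) x) ∧ (∀ x, (Δ ψ) x = h x) ∧
  (∀ x, 0 ≤ h x) ∧ (∀ x, h x ≠ 0 → 1 < ‖x‖ ∧ ‖x‖ < 2) ∧
  (∀ x, |ψ x| ≤ Cψ * (1 + ‖x‖)⁻¹) ∧ (∀ x, ‖fderiv ℝ ψ x‖ ≤ Cψ * ((1 + ‖x‖) ^ 2)⁻¹) ∧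
  (∀ x, ‖iteratedFDeriv ℝ 2 ψ x‖ ≤ Cψ * ((1 + ‖x‖) ^ 3)⁻¹) ∧ (∀ x, ‖iteratedFDeriv ℝ 3 ψ x‖ ≤ Cψ * ((1 + ‖x‖) ^ 4)⁻¹)

/-! ## The three targets -/

/-- **T-i-a · target_shellField (M; CONSTRUCTION).**  In every direction a kit field with shell structure exists (module docstring:
the intended witness and why each property holds). [folklore] -/
theorem target_shellField : ∀ e : E3, ‖e‖ = 1 →
    ∃ (A K : E3 → E3) (ψ h : E3 → ℝ) (CK κ Λ Cψ : ℝ), IsKitField e A K CK κ Λ ∧ IsShellStructure e K ψ h Cψ := by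
  sorry

/-- **T-i-b · target_signLaw (M; the SIGN LAW).**  `A1(w, K(·/s)) = (2M)⁻¹s⁻²∫h(x/s)‖w − c‖² ≥ 0` for constant-speed fields with far
field `M e` (module docstring: the two integrations by parts against radial cutoffs). [folklore] -/
theorem target_signLaw : ∀ (e : E3) (A K : E3 → E3) (ψ h : E3 → ℝ) (CK κ Λ Cψ : ℝ), ‖e‖ = 1 →
    IsKitField e A K CK κ Λ → IsShellStructure e K ψ h Cψ →
    ∀ (w : E3 → E3) (c : E3) (M : ℝ), IsConstSpeedField w c M → c = M • e →
      ∀ s : ℝ, 1 ≤ s → 0 ≤ A1 w (fun x => K (s⁻¹ • x)) := by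
  sorry

/-! ### T-i-c, the `J1` half: PROVED (generic in `K`) -/

/-- **PROVED (generic `J1` rate).**  If `DK` and `curl K` are bounded by `L` and `Dw ∈ L²`, then
`|J1(w, K(·/s))| ≤ L(2‖curl‖ + ‖curl‖²)‖Dw‖₂² / s` for `s ≥ 1`: each of the three terms of `J1` has exactly one factor
`curl K_s = s⁻¹(curl K)(·/s)` or `DK_s = s⁻¹(DK)(·/s)` and two factors from `{ω, Dw}`, `‖ω‖ ≤ ‖curl‖‖Dw‖`. [folklore] -/
theorem abs_J1_rescale_le {K : E3 → E3} (hK : ContDiff ℝ 1 K) {L : ℝ} (hDK : ∀ x, ‖fderiv ℝ K x‖ ≤ L)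
    (hcK : ∀ x, ‖curl K x‖ ≤ L) (w : E3 → E3) (hI : Integrable (fun x => ‖fderiv ℝ w x‖ ^ 2) volume)
    {s : ℝ} (hs : 1 ≤ s) :
    |J1 w (fun x => K (s⁻¹ • x))| ≤
      L * (2 * ‖curlCLM‖ + ‖curlCLM‖ ^ 2) * (∫ x, ‖fderiv ℝ w x‖ ^ 2) / s := by
  have hs0 : 0 < s := lt_of_lt_of_le one_pos hs
  have hL0 : 0 ≤ L := (norm_nonneg _).trans (hcK 0)
  have hKd : Differentiable ℝ K := hK.differentiable one_ne_zero
  set κ₀ : ℝ := ‖curlCLM‖ with hκ₀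
  have hκ₀0 : 0 ≤ κ₀ := hκ₀ ▸ norm_nonneg curlCLM
  have hsi : ‖(s⁻¹ : ℝ)‖ = s⁻¹ := by rw [Real.norm_eq_abs, abs_of_pos (inv_pos.2 hs0)]
  -- pointwise sizes of the rescaled kernel
  have hcφ : ∀ x, ‖curl (fun x => K (s⁻¹ • x)) x‖ ≤ s⁻¹ * L := fun x => by
    rw [curl_rescale hKd s x, norm_smul, hsi]; exact mul_le_mul_of_nonneg_left (hcK _) (inv_pos.2 hs0).le
  have hDφ : ∀ x, ‖fderiv ℝ (fun x => K (s⁻¹ • x)) x‖ ≤ s⁻¹ * L := fun x => by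
    rw [fderiv_rescale hKd s x, norm_smul, hsi]; exact mul_le_mul_of_nonneg_left (hDK _) (inv_pos.2 hs0).le
  have hω : ∀ x, ‖curl w x‖ ≤ κ₀ * ‖fderiv ℝ w x‖ := fun x => norm_curl_le w x
  -- the pointwise bound on the integrand
  have hptw : ∀ x,
      |⟪curl (fun x => K (s⁻¹ • x)) x, fderiv ℝ w x (curl w x)⟫_ℝ +
        ⟪curl w x, fderiv ℝ (fun x => K (s⁻¹ • x)) x (curl w x)⟫_ℝ +
        ⟪curl w x, fderiv ℝ w x (curl (fun x => K (s⁻¹ • x)) x)⟫_ℝ| ≤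
      s⁻¹ * (L * (2 * κ₀ + κ₀ ^ 2)) * ‖fderiv ℝ w x‖ ^ 2 := by
    intro x
    set a := curl (fun x => K (s⁻¹ • x)) x
    set Dφ := fderiv ℝ (fun x => K (s⁻¹ • x)) x
    set D := fderiv ℝ w x
    set Om := curl w x
    have hD0 : 0 ≤ ‖D‖ := norm_nonneg _
    have hωD : ‖Om‖ ≤ κ₀ * ‖D‖ := hω x
    have ha : ‖a‖ ≤ s⁻¹ * L := hcφ x
    have hDφ' : ‖Dφ‖ ≤ s⁻¹ * L := hDφ x
    have hsL : 0 ≤ s⁻¹ * L := mul_nonneg (inv_pos.2 hs0).le hL0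
    have h1 : |⟪a, D Om⟫_ℝ| ≤ s⁻¹ * L * κ₀ * ‖D‖ ^ 2 := by
      calc |⟪a, D Om⟫_ℝ| ≤ ‖a‖ * ‖D Om‖ := abs_real_inner_le_norm _ _
        _ ≤ (s⁻¹ * L) * (‖D‖ * (κ₀ * ‖D‖)) := by
            refine mul_le_mul ha ((D.le_opNorm Om).trans ?_) (norm_nonneg _) hsL
            exact mul_le_mul_of_nonneg_left hωD hD0
        _ = s⁻¹ * L * κ₀ * ‖D‖ ^ 2 := by ring
    have h2 : |⟪Om, Dφ Om⟫_ℝ| ≤ s⁻¹ * L * κ₀ ^ 2 * ‖D‖ ^ 2 := by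
      calc |⟪Om, Dφ Om⟫_ℝ| ≤ ‖Om‖ * ‖Dφ Om‖ := abs_real_inner_le_norm _ _
        _ ≤ (κ₀ * ‖D‖) * ((s⁻¹ * L) * (κ₀ * ‖D‖)) := by
            refine mul_le_mul hωD ((Dφ.le_opNorm Om).trans ?_) (norm_nonneg _) (mul_nonneg hκ₀0 hD0)
            exact mul_le_mul hDφ' hωD (norm_nonneg _) hsL
        _ = s⁻¹ * L * κ₀ ^ 2 * ‖D‖ ^ 2 := by ring
    have h3 : |⟪Om, D a⟫_ℝ| ≤ s⁻¹ * L * κ₀ * ‖D‖ ^ 2 := by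
      calc |⟪Om, D a⟫_ℝ| ≤ ‖Om‖ * ‖D a‖ := abs_real_inner_le_norm _ _
        _ ≤ (κ₀ * ‖D‖) * (‖D‖ * (s⁻¹ * L)) := by
            refine mul_le_mul hωD ((D.le_opNorm a).trans ?_) (norm_nonneg _) (mul_nonneg hκ₀0 hD0)
            exact mul_le_mul_of_nonneg_left ha hD0
        _ = s⁻¹ * L * κ₀ * ‖D‖ ^ 2 := by ring
    calc |⟪a, D Om⟫_ℝ + ⟪Om, Dφ Om⟫_ℝ + ⟪Om, D a⟫_ℝ|
        ≤ |⟪a, D Om⟫_ℝ + ⟪Om, Dφ Om⟫_ℝ| + |⟪Om, D a⟫_ℝ| := abs_add_le _ _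
      _ ≤ |⟪a, D Om⟫_ℝ| + |⟪Om, Dφ Om⟫_ℝ| + |⟪Om, D a⟫_ℝ| := by gcongr; exact abs_add_le _ _
      _ ≤ s⁻¹ * L * κ₀ * ‖D‖ ^ 2 + s⁻¹ * L * κ₀ ^ 2 * ‖D‖ ^ 2 + s⁻¹ * L * κ₀ * ‖D‖ ^ 2 := by linarith
      _ = s⁻¹ * (L * (2 * κ₀ + κ₀ ^ 2)) * ‖D‖ ^ 2 := by ring
  have hgi : Integrable (fun x => s⁻¹ * (L * (2 * κ₀ + κ₀ ^ 2)) * ‖fderiv ℝ w x‖ ^ 2) volume := hI.const_mul _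
  calc |J1 w (fun x => K (s⁻¹ • x))|
      ≤ ∫ x, |⟪curl (fun x => K (s⁻¹ • x)) x, fderiv ℝ w x (curl w x)⟫_ℝ +
          ⟪curl w x, fderiv ℝ (fun x => K (s⁻¹ • x)) x (curl w x)⟫_ℝ +
          ⟪curl w x, fderiv ℝ w x (curl (fun x => K (s⁻¹ • x)) x)⟫_ℝ| := by
        unfold J1; exact abs_integral_le_integral_abs
    _ ≤ ∫ x, s⁻¹ * (L * (2 * κ₀ + κ₀ ^ 2)) * ‖fderiv ℝ w x‖ ^ 2 :=
        integral_mono_of_nonneg (Eventually.of_forall fun x => abs_nonneg _) hgi (Eventually.of_forall hptw)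
    _ = L * (2 * κ₀ + κ₀ ^ 2) * (∫ x, ‖fderiv ℝ w x‖ ^ 2) / s := by
        rw [integral_const_mul]; field_simp

/-- **PROVED.**  The `J1` rate for a kit field against a constant-speed field (`L` from item 2 of the kit: `‖D²A‖ ≤ C`). -/
theorem rate_J1_of_kit {e : E3} {A K : E3 → E3} {CK κ Λ : ℝ} (hkf : IsKitField e A K CK κ Λ)
    {w : E3 → E3} {c : E3} {M : ℝ} (hw : IsConstSpeedField w c M) :
    ∃ CJ : ℝ, ∀ s : ℝ, 1 ≤ s → |J1 w (fun x => K (s⁻¹ • x))| ≤ CJ / s := by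
  obtain ⟨hA, ⟨C, hA0, hAk⟩, hKA, -, -, -, -, -, -, -⟩ := hkf
  obtain ⟨hcd, -, -, h1, -, -, -, -, -, -⟩ := hw
  subst hKA
  have hC0 : 0 ≤ C := (norm_nonneg _).trans (hA0 0)
  set κ₀ : ℝ := ‖curlCLM‖ with hκ₀
  have hκ₀0 : 0 ≤ κ₀ := hκ₀ ▸ norm_nonneg curlCLM
  -- `‖D(curl A)‖ ≤ ‖curl‖·‖D²A‖ ≤ ‖curl‖·C`, `‖curl curl A‖ ≤ ‖curl‖·‖D(curl A)‖`
  have hD2 : ∀ x, ‖iteratedFDeriv ℝ 2 A x‖ ≤ C := fun x => by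
    refine (hAk 2 (by norm_num) (by norm_num) x).trans ?_
    have h1x : (1 : ℝ) ≤ (1 + ‖x‖) ^ 2 := one_le_pow₀ (by linarith [norm_nonneg x])
    calc C * ((1 + ‖x‖) ^ 2)⁻¹ ≤ C * 1 := by gcongr; exact inv_le_one_of_one_le₀ h1x
      _ = C := mul_one C
  have hDK : ∀ x, ‖fderiv ℝ (curl A) x‖ ≤ κ₀ * C := fun x => by
    rw [← norm_iteratedFDeriv_one]
    exact (norm_iteratedFDeriv_curl_le_opNorm_mul (N := ⊤) hA 1 le_top x).trans
      (mul_le_mul_of_nonneg_left (hD2 x) hκ₀0)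
  have hcK : ∀ x, ‖curl (curl A) x‖ ≤ κ₀ * (κ₀ * C) := fun x =>
    (norm_curl_le (curl A) x).trans (mul_le_mul_of_nonneg_left (hDK x) hκ₀0)
  set L : ℝ := κ₀ * C + κ₀ * (κ₀ * C) with hL
  have hDK' : ∀ x, ‖fderiv ℝ (curl A) x‖ ≤ L := fun x => (hDK x).trans (by rw [hL]; nlinarith [mul_nonneg hκ₀0 (mul_nonneg hκ₀0 hC0)])
  have hcK' : ∀ x, ‖curl (curl A) x‖ ≤ L := fun x => (hcK x).trans (by rw [hL]; nlinarith [mul_nonneg hκ₀0 hC0])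
  have hK1 : ContDiff ℝ 1 (curl A) := contDiff_curl (n := 1) (hA.of_le (by norm_cast))
  -- `Dw ∈ L²`
  have hI : Integrable (fun x => ‖fderiv ℝ w x‖ ^ 2) volume := by
    have h1' : ∫⁻ x, ‖fderiv ℝ w x‖ₑ ^ 2 < ⊤ := by
      refine lt_of_le_of_lt (le_of_eq (lintegral_congr fun x => ?_)) h1
      rw [← ofReal_norm, ← ofReal_norm, norm_iteratedFDeriv_one]
    exact integrable_sq_norm_of_lintegral_lt_top (hcd.continuous_fderiv (by simp)) h1'
  exact ⟨L * (2 * κ₀ + κ₀ ^ 2) * ∫ x, ‖fderiv ℝ w x‖ ^ 2, fun s hs =>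
    abs_J1_rescale_le hK1 hDK' hcK' w hI hs⟩

/-! ### T-i-c, the `C1` half: target -/

/-- **T-i-c · target_rateC (S/M; the `C1` RATE).**  `C1(w, K(·/s)) = O(1/s)` for a kit field with shell structure against a
constant-speed field — after ONE integration by parts: `C1(w, K_s) = −∫⟪ω, Δ curl K_s⟫`, `Δ curl K_s = s⁻³(Δ curl K)(·/s)`,
`Δ curl K = curl(Δψ e) = curl(h e) = ∇h × e` bounded and supported in the shell, so `|C1| ≤ s^{-3/2}‖∇h‖_∞|shell₁|^{1/2}‖ω‖₂`
(Cauchy–Schwarz WITHOUT the integration by parts gives only `s^{-1/2}`, which is not enough for T).  The IBP is whole-space legitimate: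
`⟪ω, ∂ᵢcurl K_s⟫ ∈ W^{1,1}` (`ω, ∇ω ∈ L²`; `∇curl K = curl∘(D²ψ ⊗ e) = O(r⁻³) ∈ L²`; `Δ curl K` bounded, compact support).
Why it might fail: it cannot, given the structure. [folklore] -/
theorem target_rateC : ∀ (e : E3) (A K : E3 → E3) (ψ h : E3 → ℝ) (CK κ Λ Cψ : ℝ), ‖e‖ = 1 →
    IsKitField e A K CK κ Λ → IsShellStructure e K ψ h Cψ →
    ∀ (w : E3 → E3) (c : E3) (M : ℝ), IsConstSpeedField w c M →
      ∃ CC : ℝ, ∀ s : ℝ, 1 ≤ s → |C1 w (fun x => K (s⁻¹ • x))| ≤ CC / s := by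
  sorry

/-- **T-i-c · target_rates (PROVED from `rate_J1_of_kit` and the target `target_rateC`).** [folklore] -/
theorem target_rates : ∀ (e : E3) (A K : E3 → E3) (ψ h : E3 → ℝ) (CK κ Λ Cψ : ℝ), ‖e‖ = 1 →
    IsKitField e A K CK κ Λ → IsShellStructure e K ψ h Cψ →
    ∀ (w : E3 → E3) (c : E3) (M : ℝ), IsConstSpeedField w c M →
      (∃ CJ : ℝ, ∀ s : ℝ, 1 ≤ s → |J1 w (fun x => K (s⁻¹ • x))| ≤ CJ / s) ∧
      (∃ CC : ℝ, ∀ s : ℝ, 1 ≤ s → |C1 w (fun x => K (s⁻¹ • x))| ≤ CC / s) :=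
  fun e A K ψ h CK κ Λ Cψ he hkf hsh w c M hw =>
    ⟨rate_J1_of_kit hkf hw, target_rateC e A K ψ h CK κ Λ Cψ he hkf hsh w c M hw⟩

/-! ## The assembly (PROVED): T-i-a ∧ T-i-b ∧ T-i-c ⇒ T-i -/

/-- **PROVED.**  The three targets give a tail kit in every direction (the statement of `target_tailKit` of
`Lines/l2_budget_tail.lean`, character-identical). -/
theorem target_tailKit_of
    (ha : ∀ e : E3, ‖e‖ = 1 →
      ∃ (A K : E3 → E3) (ψ h : E3 → ℝ) (CK κ Λ Cψ : ℝ), IsKitField e A K CK κ Λ ∧ IsShellStructure e K ψ h Cψ)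
    (hb : ∀ (e : E3) (A K : E3 → E3) (ψ h : E3 → ℝ) (CK κ Λ Cψ : ℝ), ‖e‖ = 1 →
      IsKitField e A K CK κ Λ → IsShellStructure e K ψ h Cψ →
      ∀ (w : E3 → E3) (c : E3) (M : ℝ), IsConstSpeedField w c M → c = M • e →
        ∀ s : ℝ, 1 ≤ s → 0 ≤ A1 w (fun x => K (s⁻¹ • x)))
    (hc : ∀ (e : E3) (A K : E3 → E3) (ψ h : E3 → ℝ) (CK κ Λ Cψ : ℝ), ‖e‖ = 1 →
      IsKitField e A K CK κ Λ → IsShellStructure e K ψ h Cψ →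
      ∀ (w : E3 → E3) (c : E3) (M : ℝ), IsConstSpeedField w c M →
        (∃ CJ : ℝ, ∀ s : ℝ, 1 ≤ s → |J1 w (fun x => K (s⁻¹ • x))| ≤ CJ / s) ∧
        (∃ CC : ℝ, ∀ s : ℝ, 1 ≤ s → |C1 w (fun x => K (s⁻¹ • x))| ≤ CC / s)) :
    ∀ e : E3, ‖e‖ = 1 → ∃ (A K : E3 → E3) (CK κ Λ : ℝ), IsTailKit e A K CK κ Λ := by
  intro e he
  obtain ⟨A, K, ψ, h, CK, κ, Λ, Cψ, hkf, hsh⟩ := ha e he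
  obtain ⟨h1, h2, h3, h4, h5, h6, h7, h8, h9, h10⟩ := hkf
  refine ⟨A, K, CK, κ, Λ, h1, h2, h3, h4, h5, h6, h7, h8, h9, h10, fun w c M hw hce => ⟨?_, ?_, ?_⟩⟩
  · exact hb e A K ψ h CK κ Λ Cψ he ⟨h1, h2, h3, h4, h5, h6, h7, h8, h9, h10⟩ hsh w c M hw hce
  · exact (hc e A K ψ h CK κ Λ Cψ he ⟨h1, h2, h3, h4, h5, h6, h7, h8, h9, h10⟩ hsh w c M hw).1
  · exact (hc e A K ψ h CK κ Λ Cψ he ⟨h1, h2, h3, h4, h5, h6, h7, h8, h9, h10⟩ hsh w c M hw).2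

/-- T-i modulo the three targets (uses their `sorry`s). -/
theorem target_tailKit_holds : ∀ e : E3, ‖e‖ = 1 → ∃ (A K : E3 → E3) (CK κ Λ : ℝ), IsTailKit e A K CK κ Λ :=
  target_tailKit_of target_shellField target_signLaw target_rates

end Summit.NavierStokesRegularity.NavierStokesRegularity.Cruxes.NearExtremalTransience.L2Budget.Kit
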